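import Literature.Computability.AlgebraicComplexity.Kron444HullCheck
import HarnessLib

/-!
# `Kron(4,4,4) ⊆ conv(328 vertices)`: certificate checks, part 12/14

Proofs file (computations only): the node checks of `Kron444HullCheck.lean` for the chunks
155 … 172 of the certificate, each decided by the kernel (`decide +kernel`; `maxHeartbeats 0`:
a chunk is ≈ 10⁵–10⁶ kernel reductions). Assembled in `Kron444Hull.lean`. [folklore]
-/

set_option Elab.async false

namespace Literature.Computability.AlgebraicComplexity.Kron444Hull

/-- Nodes `3875 … 3899` of the certificate (chunk `155`) pass `checkNodeRec`. [folklore] -/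
theorem checkChunk_155 : checkChunk 155 25 = true := by
  set_option maxHeartbeats 0 in decide +kernel

/-- Nodes `3900 … 3924` of the certificate (chunk `156`) pass `checkNodeRec`. [folklore] -/
theorem checkChunk_156 : checkChunk 156 25 = true := by
  set_option maxHeartbeats 0 in decide +kernel

/-- Nodes `3925 … 3949` of the certificate (chunk `157`) pass `checkNodeRec`. [folklore] -/
theorem checkChunk_157 : checkChunk 157 25 = true := by
  set_option maxHeartbeats 0 in decide +kernel

/-- Nodes `3950 … 3974` of the certificate (chunk `158`) pass `checkNodeRec`. [folklore] -/
theorem checkChunk_158 : checkChunk 158 25 = true := by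
  set_option maxHeartbeats 0 in decide +kernel

/-- Nodes `3975 … 3999` of the certificate (chunk `159`) pass `checkNodeRec`. [folklore] -/
theorem checkChunk_159 : checkChunk 159 25 = true := by
  set_option maxHeartbeats 0 in decide +kernel

/-- Nodes `4000 … 4024` of the certificate (chunk `160`) pass `checkNodeRec`. [folklore] -/
theorem checkChunk_160 : checkChunk 160 25 = true := by
  set_option maxHeartbeats 0 in decide +kernel

/-- Nodes `4025 … 4049` of the certificate (chunk `161`) pass `checkNodeRec`. [folklore] -/
theorem checkChunk_161 : checkChunk 161 25 = true := by
  set_option maxHeartbeats 0 in decide +kernel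

/-- Nodes `4050 … 4074` of the certificate (chunk `162`) pass `checkNodeRec`. [folklore] -/
theorem checkChunk_162 : checkChunk 162 25 = true := by
  set_option maxHeartbeats 0 in decide +kernel

/-- Nodes `4075 … 4099` of the certificate (chunk `163`) pass `checkNodeRec`. [folklore] -/
theorem checkChunk_163 : checkChunk 163 25 = true := by
  set_option maxHeartbeats 0 in decide +kernel

/-- Nodes `4100 … 4124` of the certificate (chunk `164`) pass `checkNodeRec`. [folklore] -/
theorem checkChunk_164 : checkChunk 164 25 = true := by
  set_option maxHeartbeats 0 in decide +kernel

/-- Nodes `4125 … 4149` of the certificate (chunk `165`) pass `checkNodeRec`. [folklore] -/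
theorem checkChunk_165 : checkChunk 165 25 = true := by
  set_option maxHeartbeats 0 in decide +kernel

/-- Nodes `4150 … 4174` of the certificate (chunk `166`) pass `checkNodeRec`. [folklore] -/
theorem checkChunk_166 : checkChunk 166 25 = true := by
  set_option maxHeartbeats 0 in decide +kernel

/-- Nodes `4175 … 4199` of the certificate (chunk `167`) pass `checkNodeRec`. [folklore] -/
theorem checkChunk_167 : checkChunk 167 25 = true := by
  set_option maxHeartbeats 0 in decide +kernel

/-- Nodes `4200 … 4224` of the certificate (chunk `168`) pass `checkNodeRec`. [folklore] -/
theorem checkChunk_168 : checkChunk 168 25 = true := by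
  set_option maxHeartbeats 0 in decide +kernel

/-- Nodes `4225 … 4249` of the certificate (chunk `169`) pass `checkNodeRec`. [folklore] -/
theorem checkChunk_169 : checkChunk 169 25 = true := by
  set_option maxHeartbeats 0 in decide +kernel

/-- Nodes `4250 … 4274` of the certificate (chunk `170`) pass `checkNodeRec`. [folklore] -/
theorem checkChunk_170 : checkChunk 170 25 = true := by
  set_option maxHeartbeats 0 in decide +kernel

/-- Nodes `4275 … 4299` of the certificate (chunk `171`) pass `checkNodeRec`. [folklore] -/
theorem checkChunk_171 : checkChunk 171 25 = true := by
  set_option maxHeartbeats 0 in decide +kernel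

/-- Nodes `4300 … 4324` of the certificate (chunk `172`) pass `checkNodeRec`. [folklore] -/
theorem checkChunk_172 : checkChunk 172 25 = true := by
  set_option maxHeartbeats 0 in decide +kernel

end Literature.Computability.AlgebraicComplexity.Kron444Hull
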